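import Summits.QuantumAdvantage.QuantumAdvantage.Theorems.MobiusLadderLiouvilleNotTC0
import Literature.Computability.Cryptography.OneWayFunctions
import Literature.Computability.Complexity.HardCoreLemma

/-!
# Crux `MobiusLadder.LiouvilleNotPPoly` (stmt-QuantumAdvantage-1389), crux-ideate round 2, ideator 4 —
# sketch for the idea card `multiplicative-one-time-pad`

`X := L_λ ∉ P/poly` (`Summit.QuantumAdvantage.QuantumAdvantage.Theses.MobiusLadder.LiouvilleNotPPoly`).

THE LEVER. `λ(N) = λ(N·r)·λ(r)` for every `r ≠ 0` (complete multiplicativity), with `r` drawn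
TOGETHER WITH ITS FACTORISATION (Bach 1988 / Kalai 2003), hence with `λ(r)` known: a multiplicative
ONE-TIME PAD moving the worst-case instance `N` (length `n`) to the instance `N·r` at a LONGER, freely
chosen length while XOR-masking the answer by a known sign. It is the unique bridge λ's structure offers
between the crux (worst case) and the route's engine (average case / correlation), and it organises the
whole average-case axis of the crux:

* §1 `pad_identity`, `card_filter_mul_mem_le`, `good_multipliers` — the kernel of
  **T1 (subexponential-error tightness)**: `X ⟺ ∀ ε > 0`, no `P/poly` language agrees with `L_λ` off a
  `2^{-ℓ^ε}/16` fraction of the words of each large length `ℓ` (`SubexpTightness`, typed; the converse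
  direction `rareErrorFamily_of_mem_PPoly` and the corollary `crux_iff_noRareError` PROVED). Refuting
  `X` therefore needs only a RARE-ERROR family, not an exact one; and `X` IS a (very mild) average-case
  statement. Sharpens the r1 note B2(ii) (`2^{-ℓ/3}`) to every `2^{-ℓ^ε}`.
* §2 **T1′ (the ceiling)** PROVED: `flipAt p := λ` with the sign at ONE prime `p` flipped is itself
  completely multiplicative and `(1/p)`-close to `λ`, so no class-uniform ("black-box in the target")
  corrector survives error rate `1/p` (`no_classUniform_corrector`): the two worlds
  (target `λ`, oracle `flipAt p`) and (target `flipAt p`, oracle `flipAt p`) coincide. Multiplicativity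
  alone stops helping between `2^{-ℓ^{Ω(1)}}` (T1) and `2^{-ℓ^{o(1)}}`; from the `1/poly` level up
  (`MildAvgHard`) one needs properties of `λ` beyond complete multiplicativity + prime values.
* §3 the average-case notions over the tree's `Circuit`/`B2`/`PPoly`: `disagree`, `MildAvgHard c`
  (error `≥ n^{-c}` on the uniform `n`-bit instance), the apex `LiouvilleOrthogonalPPoly` (Möbius
  randomness at polynomial size = the `P/poly` rung of the ladder whose `AC⁰` rung is item 1394, PROVED,
  and whose `TC⁰` rung is item 1393), and the two compositions INTO THE CRUX BY NAME, both PROVED with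
  no `sorry`: `LiouvilleNotPPoly_of_apex`, `LiouvilleNotPPoly_of_mildAvgHard`.
* §4 the two conditional structure theorems of the axis, TYPED over existing declarations:
  **T2 (XOR self-amplification)** `SelfAmplification` — `λ^{⊕k}(N₁,…,N_k) = λ(∏ Nᵢ)`, so Yao's XOR
  lemma via Impagliazzo's hard-core lemma (IN THE TREE, proved:
  `Literature.Computability.Complexity.HardCore.exists_majority_correct`) turns `MildAvgHard` into
  correlation `≤ ε` on the Kalai product ensemble; **T3 (crypto calibration)** `WeakOWF_of_MildAvgHard` —
  the `1/poly` level already makes the Bach–Kalai map `coins ↦ N` weakly one-way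
  (`Literature.Computability.Cryptography.IsWeaklyOneWay`), hence OWF
  (`weakOWFExist_iff_OWFExist`), hence the natural-proofs premise is self-triggered FROM THAT LEVEL UP
  — and, by T1′, NOT from `X`.

`lean check`: expected rc 0, NO `sorry` (the unproved statements T1/T2/T3 are `def … : Prop`).
-/

set_option linter.dupNamespace false -- D-0017: single-problem summit ⇒ `QuantumAdvantage.QuantumAdvantage` by design

noncomputable section

namespace Summit.QuantumAdvantage.QuantumAdvantage.Cruxes.LiouvilleNotPPoly.OneTimePad

open Literature.Computability.Complexity
open Literature.Probability.RandomGraphs.LowDegree (sgn sgn_true sgn_false)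
open _root_.Computability Filter Finset
open Summit.QuantumAdvantage.QuantumAdvantage.Theorems.MobiusLadder

/-- The Liouville function as an integer-valued function on `ℕ` (Mathlib `ArithmeticFunction.liouville`,
`λ(N) = (-1)^{Ω(N)}`, `λ(0) = 0`). -/
abbrev lam (N : ℕ) : ℤ := ArithmeticFunction.liouville N

/-- The Liouville language `L_λ = {bin(N) : λ(N) = -1}` (canonical LSB-first numerals), literally the
set the crux speaks about. -/
abbrev liouvilleLang : Language Bool :=
  encodingNatBool.toLanguage {N : ℕ | ArithmeticFunction.liouville N = -1}

/-- The crux, by name, is `L_λ ∉ P/poly`. -/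
theorem crux_iff : Theses.MobiusLadder.LiouvilleNotPPoly ↔ liouvilleLang ∉ PPoly := Iff.rfl

/-! ### §1 The pad and the counting kernel of T1 -/

/-- `λ(r)² = 1` for `r ≠ 0`. [folklore] -/
theorem lam_mul_self {r : ℕ} (hr : r ≠ 0) : lam r * lam r = 1 := by
  rcases liouville_eq_one_or_eq_neg_one hr with h | h <;> simp [lam, h]

/-- **The multiplicative one-time pad.** For every multiplier `r ≠ 0`, `λ(N) = λ(N·r)·λ(r)`: the value
at the worst-case instance `N` is the value at the shifted instance `N·r`, unmasked by the KNOWN sign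
`λ(r)` (known because `r` is sampled with its factorisation — Bach 1988, Kalai 2003). [folklore] -/
theorem pad_identity (N : ℕ) {r : ℕ} (hr : r ≠ 0) : lam N = lam (N * r) * lam r := by
  have h := lam_mul_self hr
  simp only [lam] at h ⊢
  rw [ArithmeticFunction.liouville_apply_mul, mul_assoc, h, mul_one]

/-- **Counting kernel.** Multiplication by `N ≠ 0` is injective, so among any set `R` of multipliers
at most `#E` send `N·r` into a given (error) set `E`. [folklore] -/
theorem card_filter_mul_mem_le {N : ℕ} (hN : N ≠ 0) (R E : Finset ℕ) :
    (R.filter fun r => N * r ∈ E).card ≤ E.card := by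
  refine Finset.card_le_card_of_injOn (fun r => N * r) ?_ ?_
  · intro r hr
    exact (Finset.mem_filter.1 hr).2
  · intro a _ b _ hab
    exact Nat.eq_of_mul_eq_mul_left (Nat.pos_of_ne_zero hN) hab

/-- If the error set is at most a quarter of the multiplier pool, then for EVERY instance `N ≠ 0` at
least three quarters of the multipliers are good — uniformly in `N`, which is what Adleman's
hard-wiring (majority over `O(n)` sampled multipliers, union bound over the `2^n` instances) needs. -/
theorem good_multipliers {N : ℕ} (hN : N ≠ 0) (R E : Finset ℕ) (hE : 4 * E.card ≤ R.card) :
    4 * (R.filter fun r => N * r ∈ E).card ≤ R.card :=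
  le_trans (Nat.mul_le_mul_left 4 (card_filter_mul_mem_le hN R E)) hE

/-- On a good multiplier the padded oracle answer decodes correctly: if `O(N·r) = λ(N·r)` then
`O(N·r)·λ(r) = λ(N)`. -/
theorem decode_of_good {O : ℕ → ℤ} {N r : ℕ} (hr : r ≠ 0) (hgood : O (N * r) = lam (N * r)) :
    O (N * r) * lam r = lam N := by
  rw [hgood, ← pad_identity N hr]

/-! ### §1b Rare-error families and the tightness statement T1 -/

/-- The `2^ℓ` words of length `ℓ`. -/
def words (ℓ : ℕ) : Finset (List Bool) := (Finset.univ : Finset (Fin ℓ → Bool)).image List.ofFn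

open Classical in
/-- `errCount L L' ℓ`: the number of words of length `ℓ` on which the languages `L`, `L'` disagree. -/
def errCount (L L' : Language Bool) (ℓ : ℕ) : ℕ :=
  ((words ℓ).filter fun w => ¬ (w ∈ L ↔ w ∈ L')).card

/-- A language never disagrees with itself. -/
theorem errCount_self (L : Language Bool) (ℓ : ℕ) : errCount L L ℓ = 0 := by
  classical
  unfold errCount
  rw [Finset.card_eq_zero, Finset.filter_eq_empty_iff]
  intro w _ h
  exact h Iff.rfl

/-- `RareErrorFamily ε`: some `P/poly` language disagrees with `L_λ` on at most a `2^{-ℓ^ε}/16`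
fraction of the words of every large length `ℓ`. The refutation target that T1 legitimises. -/
def RareErrorFamily (ε : ℝ) : Prop :=
  ∃ L' ∈ PPoly, ∀ᶠ ℓ : ℕ in atTop,
    (errCount liouvilleLang L' ℓ : ℝ) ≤ (2 : ℝ) ^ ((ℓ : ℝ) - (ℓ : ℝ) ^ ε) / 16

/-- Trivial direction of T1: an exact family is a rare-error family. -/
theorem rareErrorFamily_of_mem_PPoly (h : liouvilleLang ∈ PPoly) (ε : ℝ) : RareErrorFamily ε := by
  refine ⟨liouvilleLang, h, Filter.Eventually.of_forall fun ℓ => ?_⟩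
  rw [errCount_self, Nat.cast_zero]
  positivity

/-- **T1 — subexponential-error tightness (statement; M-sized, provable now).** For every
`0 < ε ≤ 1`, a rare-error family at rate `2^{-ℓ^ε}/16` yields `L_λ ∈ P/poly`. Proof plan (Adleman-style,
all tools in the tree: `PPoly_eq_polyAdvice_P_holds`, `mem_SIZE_iff_circuitSize_le_holds`, `CodeFP`):
for input length `n` work at length `ℓ ≈ n^{1/ε}` (so `ℓ^ε ≥ n + 5`), multipliers `r ∈ [2^{ℓ-n-1}, 2^{ℓ-n})`;
by `good_multipliers` every `N` has `≥ 3/4` good multipliers (errors at the two lengths `ℓ-1, ℓ` number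
`≤ 2^{ℓ-ℓ^ε}/8 ≤ 2^{ℓ-n-1}/4`); sample `m = 20 n` multipliers, Chernoff + union bound over the `< 2^n`
instances, hard-wire the multipliers, their signs `λ(r_j)` and the advice of `L'` at lengths `ℓ-1, ℓ`;
decode by `decode_of_good` and majority. -/
def SubexpTightness : Prop :=
  ∀ ε : ℝ, 0 < ε → ε ≤ 1 → RareErrorFamily ε → liouvilleLang ∈ PPoly

/-- **Corollary of T1: the crux is EQUIVALENT to the absence of rare-error families** — `X` is itself a
(very mild) average-case statement, and `cdisprove` may aim at `2^{-ℓ^ε}`-error circuits. -/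
theorem crux_iff_noRareError (hT : SubexpTightness) {ε : ℝ} (hε : 0 < ε) (hε1 : ε ≤ 1) :
    Theses.MobiusLadder.LiouvilleNotPPoly ↔ ¬ RareErrorFamily ε :=
  ⟨fun hX hR => hX (hT ε hε hε1 hR), fun hR hmem => hR (rareErrorFamily_of_mem_PPoly hmem ε)⟩

/-! ### §2 T1′ — the ceiling: one flipped prime (PROVED) -/

/-- `flipAt p N := λ(N)·(-1)^{v_p(N)}` — the completely multiplicative `±1` function that agrees with `λ`
at every prime except `p`, where it is `+1`. The adversary of the two-world argument. -/
def flipAt (p : ℕ) (N : ℕ) : ℤ := lam N * (-1) ^ padicValNat p N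

/-- `flipAt p` is completely multiplicative (on nonzero arguments). -/
theorem flipAt_mul {p : ℕ} [Fact p.Prime] {a b : ℕ} (ha : a ≠ 0) (hb : b ≠ 0) :
    flipAt p (a * b) = flipAt p a * flipAt p b := by
  simp only [flipAt, lam]
  rw [ArithmeticFunction.liouville_apply_mul, padicValNat.mul ha hb, pow_add]
  ring

/-- Off the multiples of `p`, `flipAt p = λ`. -/
theorem flipAt_of_not_dvd {p N : ℕ} (h : ¬ p ∣ N) : flipAt p N = lam N := by
  simp only [flipAt]
  rw [padicValNat.eq_zero_of_not_dvd h, pow_zero, mul_one]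

/-- `λ(p) = -1` at a prime. -/
theorem lam_prime {p : ℕ} (hp : p.Prime) : lam p = -1 := by
  simp only [lam]
  rw [ArithmeticFunction.liouville_apply hp.ne_zero, ArithmeticFunction.cardFactors_apply_prime hp]
  norm_num

/-- `flipAt p p = +1`: the flipped prime. -/
theorem flipAt_prime_self {p : ℕ} (hp : p.Prime) : flipAt p p = 1 := by
  haveI := Fact.mk hp
  simp only [flipAt]
  rw [padicValNat_self, lam_prime hp]
  norm_num

/-- `λ(p q) = +1` for primes `p, q`. -/
theorem lam_prime_mul_prime {p q : ℕ} (hp : p.Prime) (hq : q.Prime) : lam (p * q) = 1 := by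
  have h : lam (p * q) = lam p * lam q := ArithmeticFunction.liouville_apply_mul p q
  rw [h, lam_prime hp, lam_prime hq]
  norm_num

/-- `flipAt p (p q) = -1` for distinct primes `p, q`. -/
theorem flipAt_prime_mul_prime {p q : ℕ} (hp : p.Prime) (hq : q.Prime) (hpq : p ≠ q) :
    flipAt p (p * q) = -1 := by
  haveI := Fact.mk hp
  rw [flipAt_mul hp.ne_zero hq.ne_zero, flipAt_prime_self hp, flipAt_of_not_dvd, lam_prime hq]
  · norm_num
  · intro h
    exact hpq ((Nat.prime_dvd_prime_iff_eq hp hq).1 h)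

/-- The disagreement set of `flipAt p` and `λ` below `X` lies inside the multiples of `p`. -/
theorem filter_flipAt_ne_subset (p X : ℕ) :
    ((Finset.range X).filter fun N => flipAt p N ≠ lam N) ⊆
      (Finset.range X).filter fun N => p ∣ N := by
  intro N hN
  rw [Finset.mem_filter] at hN ⊢
  refine ⟨hN.1, ?_⟩
  by_contra h
  exact hN.2 (flipAt_of_not_dvd h)

/-- There are at most `X / p + 1` multiples of `p` below `X`. [folklore] -/
theorem card_filter_dvd_range_le {p : ℕ} (hp : 0 < p) (X : ℕ) :
    ((Finset.range X).filter fun N => p ∣ N).card ≤ X / p + 1 := by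
  calc ((Finset.range X).filter fun N => p ∣ N).card
      ≤ ((Finset.range (X / p + 1)).image fun k => p * k).card := by
        apply Finset.card_le_card
        intro N hN
        rw [Finset.mem_filter, Finset.mem_range] at hN
        obtain ⟨k, rfl⟩ := hN.2
        rw [Finset.mem_image]
        refine ⟨k, Finset.mem_range.2 ?_, rfl⟩
        have hk : k ≤ X / p := by
          rw [Nat.le_div_iff_mul_le hp, mul_comm]
          exact hN.1.le
        omega
    _ ≤ (Finset.range (X / p + 1)).card := Finset.card_image_le
    _ = X / p + 1 := Finset.card_range _

/-- `CloseAtRate δ O f`: the oracle `O` disagrees with `f` on at most `δ·X + 1` of the arguments below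
every `X` (a density-`δ` error rate, uniformly in the cut-off). -/
def CloseAtRate (δ : ℝ) (O f : ℕ → ℤ) : Prop :=
  ∀ X : ℕ, (((Finset.range X).filter fun N => O N ≠ f N).card : ℝ) ≤ δ * X + 1

/-- Every function is close to itself. -/
theorem closeAtRate_refl {δ : ℝ} (hδ : 0 ≤ δ) (f : ℕ → ℤ) : CloseAtRate δ f f := by
  intro X
  have h : ((Finset.range X).filter fun N => f N ≠ f N) = ∅ :=
    Finset.filter_eq_empty_iff.2 fun _ _ h => h rfl
  rw [h, Finset.card_empty, Nat.cast_zero]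
  have := mul_nonneg hδ (Nat.cast_nonneg (α := ℝ) X)
  linarith

/-- **The adversary is admissible:** `flipAt p` is `(1/p)`-close to `λ`. -/
theorem closeAtRate_flipAt {p : ℕ} (hp : p.Prime) : CloseAtRate (1 / p) (flipAt p) lam := by
  intro X
  have h1 := Finset.card_le_card (filter_flipAt_ne_subset p X)
  have h2 := card_filter_dvd_range_le hp.pos X
  have h3 : ((X / p : ℕ) : ℝ) ≤ (X : ℝ) / p := Nat.cast_div_le
  have h12 : (((Finset.range X).filter fun N => flipAt p N ≠ lam N).card : ℝ) ≤ ((X / p : ℕ) : ℝ) + 1 := by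
    exact_mod_cast h1.trans h2
  calc (((Finset.range X).filter fun N => flipAt p N ≠ lam N).card : ℝ)
      ≤ ((X / p : ℕ) : ℝ) + 1 := h12
    _ ≤ 1 / (p : ℝ) * X + 1 := by rw [one_div_mul_eq_div]; linarith

/-- **T1′ — the ceiling (class form), PROVED.** For distinct primes `p, q` there is NO oracle procedure
`R` — of any complexity, adaptive, with unboundedly many queries — that computes every target
`f ∈ {λ, flipAt p}` from every oracle `(1/p)`-close to `f`: at the input `p·q` the world
(target `λ`, oracle `flipAt p`) demands `+1` and the world (target `flipAt p`, oracle `flipAt p`)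
demands `-1`, on identical data. Read with `p` an `m`-bit prime: self-correction that is uniform over
completely multiplicative `±1` targets ("uses only multiplicativity and generic prime values") cannot
take error rate `2^{-m}` to worst case — whereas T1 does take rate `2^{-ℓ^ε}` to worst case by padding
to length `ℓ = m^{1/ε}`. The gap `[2^{-ℓ^{o(1)}}, ℓ^{-O(1)}]` is where a proof of `MildAvgHard` from
`X` would have to use something λ-specific. -/
theorem no_classUniform_corrector {p q : ℕ} (hp : p.Prime) (hq : q.Prime) (hpq : p ≠ q) :
    ¬ ∃ R : (ℕ → ℤ) → ℕ → ℤ,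
      ∀ f ∈ ({lam, flipAt p} : Set (ℕ → ℤ)), ∀ O : ℕ → ℤ, CloseAtRate (1 / p) O f →
        ∀ N, R O N = f N := by
  rintro ⟨R, hR⟩
  have h1 := hR lam (by simp) (flipAt p) (closeAtRate_flipAt hp) (p * q)
  have h2 := hR (flipAt p) (by simp) (flipAt p) (closeAtRate_refl (by positivity) _) (p * q)
  rw [lam_prime_mul_prime hp hq] at h1
  rw [flipAt_prime_mul_prime hp hq hpq, h1] at h2
  norm_num at h2

/-! ### §3 The average-case axis over the tree's circuits; two compositions into the crux (PROVED) -/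

/-- The `n` low binary digits of `N` as a circuit input (the route file's convention). -/
abbrev bits (n N : ℕ) : Fin n → Bool := fun i => Nat.testBit N i

/-- The number of length-`n` INSTANCES — codewords of length `n` are exactly the numerals of
`N ∈ [2^{n-1}, 2^n)` — on which the circuit's verdict (accept ↔ "λ(N) = -1") is wrong. -/
def disagree (n : ℕ) (C : Circuit (Fin n)) : ℕ :=
  ((Finset.Ico (2 ^ (n - 1)) (2 ^ n)).filter
    fun N => C.eval (bits n N) ≠ decide (ArithmeticFunction.liouville N = -1)).card

/-- **`MildAvgHard c` — the `1/poly` level of the axis.** Eventually every `B₂`-circuit of size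
`≤ p(n)` errs on at least a `n^{-c}` fraction of the `2^{n-1}` instances of length `n`. Strictly between
`X` (⟺ error `2^{-ℓ^ε}`, T1) and the apex; the level at which T2 (amplification) and T3 (one-way
functions) start. Hypothesis-type. -/
def MildAvgHard (c : ℕ) : Prop :=
  ∀ p : Polynomial ℕ, ∀ᶠ n : ℕ in atTop, ∀ C : Circuit (Fin n), C.IsOver B2 → C.size ≤ p.eval n →
    (2 : ℝ) ^ (n - 1) ≤ (n : ℝ) ^ c * disagree n C

/-- The correlation of a circuit with `λ` below `2^n` (the route file's convention, items 1393/1394: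
`sgn true = -1`). -/
def corr (n : ℕ) (C : Circuit (Fin n)) : ℝ :=
  ∑ N ∈ Finset.range (2 ^ n), ((ArithmeticFunction.liouville N : ℤ) : ℝ) * sgn (C.eval (bits n N))

/-- **The apex `C⁺ = LiouvilleOrthogonalPPoly`** — Möbius randomness at polynomial size: for every
polynomial `p` and `ε > 0`, eventually every `B₂`-circuit of size `≤ p(n)` has correlation `≤ ε 2^n`
with `λ` below `2^n`. The `P/poly` rung of the MobiusLadder correlation ladder (its `AC⁰` rung
`LiouvilleOrthogonalAC0` = item 1394 is PROVED, its `TC⁰` rung is item 1393); the n → ∞ form of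
Sarnak's Möbius-randomness heuristic for feasible observables. Hypothesis-type, `≥ X`, never staffed. -/
def LiouvilleOrthogonalPPoly : Prop :=
  ∀ p : Polynomial ℕ, ∀ ε : ℝ, 0 < ε → ∀ᶠ n : ℕ in atTop, ∀ C : Circuit (Fin n), C.IsOver B2 →
    C.size ≤ p.eval n → |corr n C| ≤ ε * (2 : ℝ) ^ n

/-- A family deciding `L_λ`, at length `k+1`, outputs `[2^k ≤ N ∧ λ N = -1]` on the digits of
`N < 2^(k+1)` (encoding glue of the tree, `ofFn_testBit_mem_toLanguage_iff`). -/
theorem decides_eval {C : CircuitFamily} (hdec : C.Decides liouvilleLang) {k N : ℕ}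
    (hN : N < 2 ^ (k + 1)) :
    (C (k + 1)).eval (bits (k + 1) N) =
      decide (2 ^ k ≤ N ∧ ArithmeticFunction.liouville N = -1) := by
  rw [show bits (k + 1) N = fun i : Fin (k + 1) => Nat.testBit N i from rfl, hdec.eval_eq]
  have hiff := ofFn_testBit_mem_toLanguage_iff
    {N : ℕ | ArithmeticFunction.liouville N = -1} (k := k) hN
  simp only [Set.mem_setOf_eq] at hiff
  by_cases h : 2 ^ k ≤ N ∧ ArithmeticFunction.liouville N = -1
  · rw [decide_eq_true h]
    exact (Set.mem_iff_boolIndicator _ _).1 (hiff.2 h)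
  · rw [decide_eq_false h]
    exact (Set.notMem_iff_boolIndicator _ _).1 fun hm => h (hiff.1 hm)

/-- **Apex ⟹ no polynomial size bound decides `L_λ`** — the basis-`B₂`, depth-free form of the tree's
`liouvilleLang_not_mem_depthSizeClass`: a deciding family has correlation
`2^(n-1) + ∑_{N<2^(n-1)} λ(N) ≥ 2^(n-2)` (elementary cancellation `abs_sum_liouville_range_le`,
no PNT), contradicting the apex at `ε = 1/8`. -/
theorem liouvilleLang_not_mem_SIZE (H : LiouvilleOrthogonalPPoly) (p : Polynomial ℕ) :
    liouvilleLang ∉ SIZE (fun n => p.eval n) := by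
  rintro ⟨C, hC, hdec⟩
  have hev := H p (1 / 8) (by norm_num)
  obtain ⟨n, hn3, hn⟩ := ((Filter.eventually_ge_atTop 3).and hev).exists
  obtain ⟨k, rfl⟩ : ∃ k, n = k + 3 := ⟨n - 3, by omega⟩
  have hb := hn (C (k + 3)) (hC _).1 (hC _).2
  have hpow3 : 2 ^ (k + 3) = 4 * 2 ^ k + 4 * 2 ^ k := by rw [pow_add]; ring
  have heval : ∀ N : ℕ, N < 2 ^ (k + 3) →
      (C (k + 3)).eval (bits (k + 3) N) =
        decide (2 ^ (k + 2) ≤ N ∧ ArithmeticFunction.liouville N = -1) :=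
    fun N hN => decides_eval hdec hN
  -- lower half: not codewords, the circuit rejects, the term is `λ(N)`
  have hlow : ∀ N ∈ Finset.range (4 * 2 ^ k),
      ((ArithmeticFunction.liouville N : ℤ) : ℝ) * sgn ((C (k + 3)).eval (bits (k + 3) N)) =
        ((ArithmeticFunction.liouville N : ℤ) : ℝ) := by
    intro N hN
    rw [Finset.mem_range] at hN
    rw [heval N (by omega)]
    have hnot : ¬ (2 ^ (k + 2) ≤ N ∧ ArithmeticFunction.liouville N = -1) := fun h => by
      have := h.1
      rw [pow_add] at this
      omega
    rw [decide_eq_false hnot, sgn_false, mul_one]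
  -- upper half: codewords, the circuit outputs `[λ N = -1]`, the term is `1`
  have hhigh : ∀ M ∈ Finset.range (4 * 2 ^ k),
      ((ArithmeticFunction.liouville (4 * 2 ^ k + M) : ℤ) : ℝ) *
          sgn ((C (k + 3)).eval (bits (k + 3) (4 * 2 ^ k + M))) = 1 := by
    intro M hM
    rw [Finset.mem_range] at hM
    rw [heval _ (by omega)]
    have hle : 2 ^ (k + 2) ≤ 4 * 2 ^ k + M := by rw [pow_add]; omega
    have hne : 4 * 2 ^ k + M ≠ 0 := by positivity
    rcases liouville_eq_one_or_eq_neg_one hne with h1 | h1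
    · have hnot : ¬ (2 ^ (k + 2) ≤ 4 * 2 ^ k + M ∧
          ArithmeticFunction.liouville (4 * 2 ^ k + M) = -1) := by
        rintro ⟨-, h⟩
        rw [h1] at h
        norm_num at h
      rw [decide_eq_false hnot, sgn_false, h1]
      simp
    · rw [decide_eq_true ⟨hle, h1⟩, sgn_true, h1]
      simp
  have hsum : corr (k + 3) (C (k + 3)) =
      ∑ N ∈ Finset.range (4 * 2 ^ k), ((ArithmeticFunction.liouville N : ℤ) : ℝ) + 4 * 2 ^ k := by
    unfold corr
    rw [hpow3, Finset.sum_range_add, Finset.sum_congr rfl hlow, Finset.sum_congr rfl hhigh]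
    simp
  have hT := abs_sum_liouville_range_le (2 ^ k)
  rw [hsum] at hb
  have h8 : (1 / 8 : ℝ) * (2 : ℝ) ^ (k + 3) = (2 : ℝ) ^ k := by
    rw [pow_add]
    ring
  rw [h8] at hb
  have hpos : (0 : ℝ) < (2 : ℝ) ^ k := by positivity
  have h1 := (abs_le.1 hb).2
  have h2 := (abs_le.1 hT).1
  push_cast at h1 h2
  linarith

/-- **Composition 1 (PROVED): the apex concludes the crux BY NAME.** `LiouvilleOrthogonalPPoly → X`. -/
theorem LiouvilleNotPPoly_of_apex (H : LiouvilleOrthogonalPPoly) :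
    Theses.MobiusLadder.LiouvilleNotPPoly := by
  intro hmem
  have hmem' : liouvilleLang ∈ PPoly := hmem
  simp only [PPoly, Set.mem_iUnion] at hmem'
  obtain ⟨p, hp⟩ := hmem'
  exact liouvilleLang_not_mem_SIZE H p hp

/-- An exact decider has no disagreement on the instances of any length `k+1`. -/
theorem disagree_eq_zero_of_decides {C : CircuitFamily} (hdec : C.Decides liouvilleLang) (k : ℕ) :
    disagree (k + 1) (C (k + 1)) = 0 := by
  unfold disagree
  rw [Finset.card_eq_zero, Finset.filter_eq_empty_iff]
  intro N hN h
  rw [Finset.mem_Ico] at hN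
  rw [Nat.add_sub_cancel] at hN
  apply h
  rw [decides_eval hdec hN.2]
  by_cases hl : ArithmeticFunction.liouville N = -1
  · rw [decide_eq_true ⟨hN.1, hl⟩, decide_eq_true hl]
  · rw [decide_eq_false (fun h' => hl h'.2), decide_eq_false hl]

/-- **Composition 2 (PROVED): the `1/poly` level concludes the crux BY NAME.** `MildAvgHard c → X`
(an exact decider has `disagree = 0 < 2^{n-1}/n^c`). -/
theorem LiouvilleNotPPoly_of_mildAvgHard {c : ℕ} (H : MildAvgHard c) :
    Theses.MobiusLadder.LiouvilleNotPPoly := by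
  intro hmem
  have hmem' : liouvilleLang ∈ PPoly := hmem
  simp only [PPoly, Set.mem_iUnion] at hmem'
  obtain ⟨p, C, hC, hdec⟩ := hmem'
  have hev := H p
  obtain ⟨n, hn1, hn⟩ := ((Filter.eventually_ge_atTop 1).and hev).exists
  obtain ⟨k, rfl⟩ : ∃ k, n = k + 1 := ⟨n - 1, by omega⟩
  have hb := hn (C (k + 1)) (hC _).1 (hC _).2
  rw [disagree_eq_zero_of_decides hdec k, Nat.cast_zero, mul_zero] at hb
  have hpos : (0 : ℝ) < (2 : ℝ) ^ (k + 1 - 1) := by positivity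
  linarith

/-! ### §4 The conditional structure of the axis: T2 and T3 (TYPED over existing declarations) -/

/-- The correlation of a circuit on `k·n` input bits with `λ` on the **Kalai product ensemble**
`D_{n,k}`: the product of `k` independent uniform instances of length `n` (numbers in
`[2^{n-1}, 2^n)`), read through its `k·n` low digits. Normalised to `[-1, 1]`. -/
def prodCorr (n k : ℕ) (C : Circuit (Fin (k * n))) : ℝ :=
  (∑ v : Fin k → Fin (2 ^ (n - 1)),
      ((ArithmeticFunction.liouville (∏ i, (2 ^ (n - 1) + (v i : ℕ))) : ℤ) : ℝ) *
        sgn (C.eval (bits (k * n) (∏ i, (2 ^ (n - 1) + (v i : ℕ)))))) /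
    ((2 : ℝ) ^ (n - 1)) ^ k

/-- **T2 — XOR self-amplification on Kalai products (statement; M/L, provable from the tree's hard-core
lemma).** Because `λ(∏ Nᵢ) = ∏ λ(Nᵢ)` (`ArithmeticFunction.liouville_apply_mul`), a predictor for `λ` on
the product ensemble is a predictor for the XOR `λ(N₁) ⊕ ⋯ ⊕ λ(N_k)` given the tuple; so Yao's XOR
lemma — via Impagliazzo's hard-core lemma, PROVED in the tree as
`Literature.Computability.Complexity.HardCore.exists_majority_correct` — turns the `1/poly` level into
vanishing correlation on `D_{n,k}` for a polynomial `k`: under `MildAvgHard c`, for every polynomial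
size bound and `ε > 0`, eventually every `B₂`-circuit on the product has `|prodCorr| ≤ ε`.
A conditional Chowla-type statement for `λ` on a thin multiplicative ensemble, internal to `λ`.
[cite: Impagliazzo1995, Thm. 1–2] [cite: GoldreichNisanWigderson1995 (Yao's XOR lemma), Thm. 1] -/
def SelfAmplification : Prop :=
  ∀ c : ℕ, MildAvgHard c → ∀ p : Polynomial ℕ, ∀ ε : ℝ, 0 < ε →
    ∃ k : ℕ → ℕ, (∃ d : ℕ, ∀ n, k n ≤ n ^ d + d) ∧ (∀ n, 1 ≤ k n) ∧
      ∀ᶠ n : ℕ in atTop, ∀ C : Circuit (Fin (k n * n)), C.IsOver B2 →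
        C.size ≤ p.eval (k n * n) → |prodCorr n (k n) C| ≤ ε

/-- **T3 — crypto calibration (statement; M/L).** The `1/poly` level already yields one-way functions:
if `λ` errs on `≥ n^{-c}` of the instances for every polynomial-size family, then FACTORING fails on
`≥ n^{-c}/2` of uniformly random `n`-bit integers for every PPT (else factor, read off `Ω mod 2`,
fix coins à la Adleman), so the Bach–Kalai map `coins ↦ N` (uniformly random FACTORED integers in
expected polynomial time, Kalai 2003; failure probability made `2^{-n}` by repetition) is WEAKLY one-way
in the tree's sense `Literature.Computability.Cryptography.IsWeaklyOneWay` (Goldreich Def. 2.2.2),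
hence one-way functions exist (`weakOWFExist_iff_OWFExist`, Yao) and, with HILL/GGM, pseudorandom
functions: the natural-proofs premise is a CONSEQUENCE of this level of the axis. By T1′ it is NOT a
black-box consequence of `X`. [cite: Kalai2003, Thm. 1] [cite: Goldreich2001, Def. 2.2.2 and Thm. 2.3.2] -/
def WeakOWF_of_MildAvgHard : Prop :=
  (∃ c : ℕ, MildAvgHard c) →
    ∃ f : List Bool → List Bool, Literature.Computability.Cryptography.IsWeaklyOneWay f

/-! ### Read-back checks -/

#check @LiouvilleNotPPoly_of_apex
#check @LiouvilleNotPPoly_of_mildAvgHard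
#check @no_classUniform_corrector
#check @crux_iff_noRareError
#check @Literature.Computability.Complexity.HardCore.exists_majority_correct
#check @Literature.Computability.Cryptography.IsWeaklyOneWay

end Summit.QuantumAdvantage.QuantumAdvantage.Cruxes.LiouvilleNotPPoly.OneTimePad

end
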